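import Literature.Probability.LatticeModels.TorusFourierWienerBound
import Literature.MathematicalPhysics.QuantumLattice.HubbardGridCounterQuadratic
import Literature.MathematicalPhysics.QuantumLattice.HubbardUVSymbolCTDifferences
import HarnessLib

/-!
# The `ℓ¹` size `Σ_z ‖Ǩ_L(z)‖` of the frame's lattice position kernel from the frame's differences at step `2π/L`

Topic `MathematicalPhysics/QuantumLattice`; companion of `HubbardGridCounterQuadratic` (`framePosKernel L K`: `Ǩ_L(z) = L⁻² Σ_q K(p_q) conj χ_q(z)`,
there bounded by the presentation-dependent `coeffNorm 0 K`) and `HubbardGridCounterQuadraticL1` (the pinned norm of the grid counterterm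
vertex through `Σ_z ‖Ǩ_L(z)‖`).  Here the INTRINSIC bound: by the Wiener-type inequality of `TorusFourierWienerBound` applied to the samples
`q ↦ K(p_q)` (a `(2πℤ)²`-periodic function sampled on the `L`-torus, so lattice shifts are continuum shifts by `2π/L`),

  `Σ_z ‖Ǩ_L(z)‖ ≤ 6·√(S₀² + L²D₁²/8 + L⁴D₂²/256)`      (**`sum_norm_framePosKernel_le_of_differences`**)

whenever `|K| ≤ S₀`, `|K(p + (2π/L)e_j) - K(p)| ≤ D₁` and `|K(p + (2π/L)e₀ + (2π/L)e₁) - K(p + (2π/L)e₀) - K(p + (2π/L)e₁) + K(p)| ≤ D₂`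
on `ℝ²` — with `D₁ ≤ ‖DK‖_∞·2π/L`, `D₂ ≤ ‖D²K‖_∞·(2π/L)²` this is `≤ 6(S₀ + π‖DK‖_∞/√2 + π²‖D²K‖_∞/4)`, uniformly in `L`, and depends on
`K` only through `K.eval` (as every a-priori class of frames does).

* `framePosKernel_eq_torusFourier` — `Ǩ_L = L⁻²·(K ∘ p)^`;
* `eval_latticeMomentum_add_single`, `eval_latticeMomentum_add_single_add_single` — lattice shifts are continuum shifts;
* **`sum_norm_framePosKernel_le_of_differences`**.

Everything is proved; no definitions, no named facts.

## Sources

G. Benfatto, A. Giuliani, V. Mastropietro, Ann. Henri Poincaré 4 (2003) 137–193, §1.2 (2.10) (the counterterm `Σ_k δε(k)ψ⁺ψ⁻` and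
its position kernel) [`BenfattoGiulianiMastropietro2003`]; S. Friedli, Y. Velenik, CUP 2017, §10.4 [`FriedliVelenik2017`].
-/

noncomputable section

namespace Literature.MathematicalPhysics.QuantumLattice

open Finset Literature.Probability.LatticeModels
open scoped ComplexConjugate

variable {L : ℕ} [NeZero L]

/-- **`Ǩ_L = L⁻²·(K ∘ p)^`**: the frame's position kernel is the normalised discrete Fourier transform of the samples `q ↦ K(p_q)`.
[cite: BenfattoGiulianiMastropietro2003, §1.2 The model (2.10)] -/
theorem framePosKernel_eq_torusFourier (K : TrigPolyC4v) (z : TorusSite 2 L) :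
    framePosKernel L K z = ((L : ℂ) ^ 2)⁻¹ * torusFourier (fun q => (K.eval (latticeMomentum L q) : ℂ)) z := by
  rw [framePosKernel, torusFourier_eq_sum_torusChar]
  congr 1
  exact sum_congr rfl fun q _ => by rw [torusChar_comm]

/-- **A unit lattice shift is a continuum shift by `2π/L`** (periodicity of the frame):
`K(p_{q + e_j}) = K(p_q + (2π/L)e_j)`. [cite: BenfattoGiulianiMastropietro2003, §1.2 The model (2.10)] -/
theorem eval_latticeMomentum_add_single (K : TrigPolyC4v) (q : TorusSite 2 L) (j : Fin 2) :
    K.eval (latticeMomentum L (q + Pi.single j 1)) =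
      K.eval (latticeMomentum L q + (2 * Real.pi / L) • (Pi.single j (1 : ℝ) : Fin 2 → ℝ)) := by
  obtain ⟨z, hz⟩ := latticeMomentum_add_smul_single_eq q j 1
  rw [one_smul, Nat.cast_one, one_mul] at hz
  rw [hz, TrigPolyC4v.eval_periodic]

/-- Two unit lattice shifts: `K(p_{q + e₀ + e₁}) = K(p_q + (2π/L)e₀ + (2π/L)e₁)`. [cite: BenfattoGiulianiMastropietro2003, §1.2 The model (2.10)] -/
theorem eval_latticeMomentum_add_single_add_single (K : TrigPolyC4v) (q : TorusSite 2 L) (j j' : Fin 2) :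
    K.eval (latticeMomentum L (q + Pi.single j 1 + Pi.single j' 1)) =
      K.eval (latticeMomentum L q + (2 * Real.pi / L) • (Pi.single j (1 : ℝ) : Fin 2 → ℝ) +
        (2 * Real.pi / L) • (Pi.single j' (1 : ℝ) : Fin 2 → ℝ)) := by
  obtain ⟨z, hz⟩ := latticeMomentum_add_smul_single_eq (q + Pi.single j 1) j' 1
  obtain ⟨z', hz'⟩ := latticeMomentum_add_smul_single_eq q j 1
  rw [one_smul, Nat.cast_one, one_mul] at hz hz'
  rw [hz]
  have h : (fun i => ((latticeMomentum L (q + Pi.single j 1) + (2 * Real.pi / L) • (Pi.single j' (1 : ℝ) : Fin 2 → ℝ)) : Fin 2 → ℝ) i +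
      z i * (2 * Real.pi)) =
      fun i => (latticeMomentum L q + (2 * Real.pi / L) • (Pi.single j (1 : ℝ) : Fin 2 → ℝ) +
        (2 * Real.pi / L) • (Pi.single j' (1 : ℝ) : Fin 2 → ℝ)) i + (((z' + z) i : ℤ) : ℝ) * (2 * Real.pi) := by
    funext i
    rw [hz']
    simp only [Pi.add_apply, Pi.smul_apply, Int.cast_add]
    ring
  rw [h, TrigPolyC4v.eval_periodic K _ (z' + z)]

/-- **The intrinsic `ℓ¹` bound on the frame's position kernel**: if `|K| ≤ S₀`, the first differences of `K` at step `2π/L` along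
`e₀, e₁` are `≤ D₁` and the mixed second difference is `≤ D₂` (everywhere on `ℝ²`), then
`Σ_z ‖Ǩ_L(z)‖ ≤ 6·√(S₀² + L²D₁²/8 + L⁴D₂²/256)`. [cite: BenfattoGiulianiMastropietro2003, §1.2 The model (2.10)] -/
theorem sum_norm_framePosKernel_le_of_differences (K : TrigPolyC4v) {S₀ D₁ D₂ : ℝ}
    (h0 : ∀ p : Fin 2 → ℝ, |K.eval p| ≤ S₀)
    (h1 : ∀ (p : Fin 2 → ℝ) (j : Fin 2), |K.eval (p + (2 * Real.pi / L) • (Pi.single j (1 : ℝ) : Fin 2 → ℝ)) - K.eval p| ≤ D₁)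
    (h2 : ∀ p : Fin 2 → ℝ, |K.eval (p + (2 * Real.pi / L) • (Pi.single 0 (1 : ℝ) : Fin 2 → ℝ) +
        (2 * Real.pi / L) • (Pi.single 1 (1 : ℝ) : Fin 2 → ℝ)) -
        K.eval (p + (2 * Real.pi / L) • (Pi.single 0 (1 : ℝ) : Fin 2 → ℝ)) -
        K.eval (p + (2 * Real.pi / L) • (Pi.single 1 (1 : ℝ) : Fin 2 → ℝ)) + K.eval p| ≤ D₂) :
    ∑ z : TorusSite 2 L, ‖framePosKernel L K z‖ ≤
      6 * Real.sqrt (S₀ ^ 2 + (L : ℝ) ^ 2 / 8 * D₁ ^ 2 + (L : ℝ) ^ 4 / 256 * D₂ ^ 2) := by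
  set g : TorusSite 2 L → ℂ := fun q => (K.eval (latticeMomentum L q) : ℂ) with hg
  have hnorm : ∀ z, ‖framePosKernel L K z‖ = ((L : ℝ) ^ 2)⁻¹ * ‖torusFourier g z‖ := by
    intro z
    rw [framePosKernel_eq_torusFourier, norm_mul, norm_inv, norm_pow, Complex.norm_natCast]
  simp_rw [hnorm]
  rw [← mul_sum]
  refine sum_norm_torusFourier_le_of_differences g (fun q => ?_) (fun j q => ?_) (fun q => ?_)
  · rw [hg]; dsimp only
    rw [Complex.norm_real, Real.norm_eq_abs]
    exact h0 _
  · rw [hg]; dsimp only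
    rw [← Complex.ofReal_sub, Complex.norm_real, Real.norm_eq_abs, eval_latticeMomentum_add_single]
    exact h1 _ j
  · rw [hg]; dsimp only
    rw [← Complex.ofReal_sub, ← Complex.ofReal_sub, ← Complex.ofReal_add, Complex.norm_real, Real.norm_eq_abs,
      eval_latticeMomentum_add_single_add_single, eval_latticeMomentum_add_single, eval_latticeMomentum_add_single]
    exact h2 _

end Literature.MathematicalPhysics.QuantumLattice

end
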